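import Summits.CriticalPhenomena.PercolationContinuityZ3.Theorems.PercNearOneGluingNoHeavyQuantResidRecursionStep
import HarnessLib

/-!
# QUANT lane R8, T-DEC: THE PEEL STEP OF `LightResidDECOracle` IN ITS OWN TERMS — an oracle-OK heavy head, an aff-OK tail: the width induction
# plus the U-part give the canonical residual's DEC at the capped floor (arm-1 gen 52, architect)

builds on p205010 (kernel theorem, internal audit signed; external expert review pending)

Support file (`--supports stmt-CriticalPhenomena-4575`), QUANT lane seat prim-quant-arm-1 (gen 52, architect); memo
`run/shared/lean/prim/quant/prim-quant-arm-1-g52/ARCH-G52.md` §3.1.  Theorems only, standard axioms, no sorries.  Sequel of `…QuantResidRecursionStep`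
(`decAt_resid_cons_of_upart`), discharging its floor and head hypotheses from the oracle data of `…QuantLightResidDECOracle` (`Sib.OracleOK` =
`Sib.AffOK` ∧ `SDECLight x₁ M ρ`).

* `ftop_mul_le_fmean_of_affOK` — `x·ftop L ≤ fmean L` for an aff-OK list (top-affordability of the forest at its floor, law level).
* **`decAt_resid_cons_of_upart_oracle`** — `s` oracle-OK with `t.q ≤ s.q` (`t` the next member) and HEAVY (`1 − s.q ≤ flaw L′ 0`), `L′ = t :: u :: L₂` aff-OK,
  `0 < x`, `0 < a < 1`: DEC of `resid a (wco a L′) L′` at `min (a x) (1/2)` below `ftop L′` (the width induction) and DEC of the U-part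
  `gate_{a q}(ρ_s ∗ H)` at `min (a x) (1/2)` below `M_s + ftop L′` ⟹ DEC of `resid a (wco a (s :: L′)) (s :: L′)` at `min (a x) (1/2)` at every layer below
  its top, i.e. `LightResidDECAt x a (s :: L′)`.  So along any heavy-head peeling order the conjecture `LightResidDECOracle` is EXACTLY the DEC of the
  U-parts met on the way (arm-1 g47's conditioned compounds, heavy-single orientation); `…QuantThreeRootHeavySingleStep/Oracle` is the width-3 balanced case
  at tree level, `…QuantResidSiblingTail` certifies every phase-1 layer of every residual regardless.

HONEST STATUS: a reduction, not a proof of the node; `LightResidDECOracle`, `LightResidDEC`, `LightSiblingStep`, `FarTreeRow` OPEN; RATE class log\*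
/ honest sentence of `run/shared/lean/prim/quant/README.md` unchanged.  [this work].  Nothing here is cited as a published result.  The gluing rows
served [cite: KozmaNitzan2024, Conjecture 3 (p. 15)]; product measure [cite: Grimmett1999, §1.3 p. 10].
-/

noncomputable section

open scoped BigOperators

namespace Summit.CriticalPhenomena.PercolationContinuityZ3.Theorems
namespace Quant
namespace LawDec

open Finset

/-! ### The peel step in the oracle form's own terms -/

/-- top-affordability of an aff-OK list at the forest floor: `x·ftop L ≤ fmean L` (`0 ≤ x`, every member `x ≤ q·x₁`, `x₁·M ≤ mean`). [this work] -/
theorem ftop_mul_le_fmean_of_affOK {x : ℝ} (hx0 : 0 ≤ x) :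
    ∀ L : List Sib, (∀ v ∈ L, v.AffOK x) → x * (ftop L : ℝ) ≤ fmean L
  | [], _ => by simp [ftop, fmean]
  | v :: L, hL => by
    have hv := hL v List.mem_cons_self
    have ih := ftop_mul_le_fmean_of_affOK hx0 L fun w hw => hL w (List.mem_cons_of_mem v hw)
    obtain ⟨⟨hq0, _, _, _, _⟩, hx₁0, hxq, hta⟩ := hv
    show x * ((ftop L + v.M : ℕ) : ℝ) ≤ fmean L + v.q * v.mean
    have h1 : x * (v.M : ℝ) ≤ v.q * v.x₁ * (v.M : ℝ) := mul_le_mul_of_nonneg_right hxq (Nat.cast_nonneg _)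
    have h2 : v.q * v.x₁ * (v.M : ℝ) ≤ v.q * v.mean := by
      have := mul_le_mul_of_nonneg_left hta hq0.le
      linarith [this]
    push_cast
    linarith

/-- **THE PEEL STEP OF `LightResidDECOracle`** (law level, capped floor `min (a·x) (1/2)`): an ORACLE-OK heavy head `s` (`1 − s.q ≤ flaw L′ 0`) whose root gate
is at least the second member's, an aff-OK tail `L′` with at least two members, `0 < x < 1`, `0 < a < 1`: if the tail's canonical residual is DEC at the capped
floor below `ftop L′` (the induction on the width) and the U-part `gate_{a q}(ρ_s ∗ H)` (`H = (flaw L′ − (1−q)δ₀)/q`) is DEC at the capped floor below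
`M_s + ftop L′`, then the canonical residual of `s :: L′` is DEC at the capped floor at every layer below its top (`LightResidDECAt x a (s :: L′)` unfolded).
The scaled head is certified by the member's light oracle (`SDECLight` at the gate `a·q`). [this work] -/
theorem decAt_resid_cons_of_upart_oracle {x a : ℝ} (hx0 : 0 < x) (ha0 : 0 < a) (ha1 : a < 1) (s t u : Sib) (L₂ : List Sib)
    (hsO : s.OracleOK x) (hL' : ∀ v ∈ t :: u :: L₂, v.AffOK x) (hq : t.q ≤ s.q) (hheavy : 1 - s.q ≤ flaw (t :: u :: L₂) 0)
    (hD' : ∀ j, j < ftop (t :: u :: L₂) →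
      DECAt (min (a * x) (1 / 2)) j (ftop (t :: u :: L₂)) (resid a (wco a (t :: u :: L₂)) (t :: u :: L₂)))
    (hU : ∀ j, j < s.M + ftop (t :: u :: L₂) → DECAt (min (a * x) (1 / 2)) j (s.M + ftop (t :: u :: L₂))
      (gate (lconv s.M (ftop (t :: u :: L₂)) s.ρ
        (fun k => (flaw (t :: u :: L₂) k - (1 - s.q) * (if k = 0 then (1 : ℝ) else 0)) / s.q)) (a * s.q)))
    (j : ℕ) (hj : j < ftop (s :: t :: u :: L₂)) :
    DECAt (min (a * x) (1 / 2)) j (ftop (s :: t :: u :: L₂)) (resid a (wco a (s :: t :: u :: L₂)) (s :: t :: u :: L₂)) := by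
  obtain ⟨⟨hsLaw, hx₁0, hxq, hta⟩, hS⟩ := hsO
  obtain ⟨hq0, hq1, ρ0, ρM, ρ1⟩ := hsLaw
  have hL'law : ∀ v ∈ t :: u :: L₂, v.LawOK := fun v hv => (hL' v hv).1
  -- the capped floor
  set y : ℝ := min (a * x) (1 / 2) with hy
  have hy0 : 0 < y := lt_min (mul_pos ha0 hx0) (by norm_num)
  have hy1 : y < 1 := lt_of_le_of_lt (min_le_right _ _) (by norm_num)
  have hyax : y ≤ a * x := min_le_left _ _
  -- canonical weights: the head's ratio is dominated because its gate is at least the second member's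
  have hwco : wco a (s :: t :: u :: L₂) = rfac a s * wco a (t :: u :: L₂) :=
    wco_cons_eq_rfac_mul a s t (u :: L₂) (rfac_mul_wco_le_rprod ha0.le ha1.le s t (u :: L₂) ⟨hq0, hq1, ρ0, ρM, ρ1⟩ hL'law hq)
  -- floors
  have hta_s : y * (s.M : ℝ) ≤ a * s.q * s.mean := by
    have h1 : y * (s.M : ℝ) ≤ a * x * (s.M : ℝ) := mul_le_mul_of_nonneg_right hyax (Nat.cast_nonneg _)
    have h2 : a * x * (s.M : ℝ) ≤ a * (s.q * s.x₁) * (s.M : ℝ) :=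
      mul_le_mul_of_nonneg_right (mul_le_mul_of_nonneg_left hxq ha0.le) (Nat.cast_nonneg _)
    have h3 : a * (s.q * s.x₁) * (s.M : ℝ) = a * s.q * (s.x₁ * (s.M : ℝ)) := by ring
    have h4 : a * s.q * (s.x₁ * (s.M : ℝ)) ≤ a * s.q * s.mean := mul_le_mul_of_nonneg_left hta (mul_nonneg ha0.le hq0.le)
    linarith
  have hta' : y * (ftop (t :: u :: L₂) : ℝ) ≤ a * fmean (t :: u :: L₂) := by
    have h1 : y * (ftop (t :: u :: L₂) : ℝ) ≤ a * x * (ftop (t :: u :: L₂) : ℝ) := mul_le_mul_of_nonneg_right hyax (Nat.cast_nonneg _)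
    have h2 := ftop_mul_le_fmean_of_affOK hx0.le (t :: u :: L₂) hL'
    have h3 : a * x * (ftop (t :: u :: L₂) : ℝ) = a * (x * (ftop (t :: u :: L₂) : ℝ)) := by ring
    have h4 := mul_le_mul_of_nonneg_left h2 ha0.le
    linarith
  -- the scaled head is DEC at `y` by the light oracle at the gate `a q`
  have hDs : ∀ j'', j'' < s.M → DECAt y j'' s.M (gate s.ρ (a * s.q)) := by
    intro j'' hj''
    have haq0 : 0 < a * s.q := mul_pos ha0 hq0
    have haq1 : a * s.q ≤ 1 := by nlinarith
    have d := hS (a * s.q) haq0 haq1 j'' hj''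
    have hle : y ≤ min (a * s.q * s.x₁) (1 / 2) := by
      refine le_min ?_ (min_le_right _ _)
      calc y ≤ a * x := hyax
        _ ≤ a * (s.q * s.x₁) := mul_le_mul_of_nonneg_left hxq ha0.le
        _ = a * s.q * s.x₁ := by ring
    exact decAt_mono_floor hle (lt_of_le_of_lt (min_le_right _ _) (by norm_num)) d
  exact decAt_resid_cons_of_upart ha0 ha1 s t u L₂ ⟨hq0, hq1, ρ0, ρM, ρ1⟩ hL'law hwco hheavy hy0 hy1 hta_s hta' hDs hD' hU j hj


end LawDec
end Quant
end Summit.CriticalPhenomena.PercolationContinuityZ3.Theorems
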